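import Summits.CriticalPhenomena.PercolationContinuityZ3.Theorems.Transplant.ProdZ2Paths
import HarnessLib

/-!
# `F □ H` (a finite graph times ANY graph), p205010-free routing: SELF-AVOIDING PATHS IN A BOX PRODUCT — fibre paths in a column, base legs at a fixed fibre
# level, and the LEG LIFT that descends in the last-but-one column (vertex-disjointness of lifted legs from COLUMN-disjointness of the base legs, for ARBITRARY `F`)

builds on p205010 (kernel theorem, internal audit signed; external expert review pending) — NOT used in this file.
Lane `prim-bschramm`, seat `prim-bschramm-p2` (gen 51; class C1b, METHOD = input substitution; memo `HOME/bschramm/P2-LATTICES.md` §162); helper file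
(`--supports stmt-CriticalPhenomena-4575 --as helper`).  «ProdZ2Paths» (gen 50) proved the leg lift for `F □ ℤ²`; its proof uses nothing about `ℤ²`.  This file states
it for the box product `F □ H` with an ARBITRARY base graph `H` (used with `H = 𝕋` in «ProdTriHubRoute»; available for the honeycomb, kagome, … twins):
* §1 the column path `col q L` and the level path `lev g π` («VPathKit».`GPath` of `F □ H` from a `GPath` of `F` / of `H`; Mathlib `boxProdLeft` / `boxProdRight`),
  their columns and levels;
* §2 **`FinProd.exists_liftLeg`**: a base self-avoiding leg `π : p ⇝ a` of `≥ 2` columns, a fibre level `x` and a target vertex `(g, a)` give a self-avoiding path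
  of `F □ H` from `(x, p)` to `(g, a)` over the columns of `π`, at level `x` except over the last-but-one column (where it runs through an `F`-path `x ⇝ g`,
  «ProdZ2Paths».`exists_gpath`) and over `a` (visited only at the end vertex).
[cite: DuminilCopinSidoraviciusTassion2016, §2.3 (proof of Fact 2: the three disjoint self-avoiding paths in B̄_R(z))]
-/

noncomputable section

namespace Summit.CriticalPhenomena.PercolationContinuityZ3.Theorems.Transplant

namespace FinProd

open SimpleGraph
open scoped Classical

variable {W X : Type} (F : SimpleGraph W) (H : SimpleGraph X)

/-! ## §1 Column paths and level paths of a box product -/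

/-- **The column path** over the base vertex `q`: an `F`-path run inside `{·} × {q}`. [folklore] -/
def col (q : X) (L : List W) : List (W × X) := L.map fun g => (g, q)

/-- **The level path** at fibre level `g`: a base path run inside `{g} × H`. [folklore] -/
def lev (g : W) (π : List X) : List (W × X) := π.map fun x => (g, x)

omit F H in
/-- Membership in a column path. [folklore] -/
@[simp] theorem mem_col {q : X} {L : List W} {v : W × X} : v ∈ col q L ↔ v.2 = q ∧ v.1 ∈ L := by
  constructor
  · rintro h
    obtain ⟨g, hg, rfl⟩ := List.mem_map.1 h
    exact ⟨rfl, hg⟩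
  · rintro ⟨h2, h1⟩
    exact List.mem_map.2 ⟨v.1, h1, by rw [← h2]⟩

omit F H in
/-- Membership in a level path. [folklore] -/
@[simp] theorem mem_lev {g : W} {π : List X} {v : W × X} : v ∈ lev g π ↔ v.2 ∈ π ∧ v.1 = g := by
  constructor
  · rintro h
    obtain ⟨x, hx, rfl⟩ := List.mem_map.1 h
    exact ⟨hx, rfl⟩
  · rintro ⟨h2, h1⟩
    exact List.mem_map.2 ⟨v.2, h2, by rw [← h1]⟩

/-- **A column path is a self-avoiding path of `F □ H`** (Mathlib's embedding `boxProdLeft`). [folklore] -/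
theorem gpath_col {q : X} {L : List W} {x y : W} (h : GPath F L x y) : GPath (F □ H) (col q L) (x, q) (y, q) :=
  h.mapEmb (F.boxProdLeft H q)

/-- **A level path is a self-avoiding path of `F □ H`** (Mathlib's embedding `boxProdRight`). [folklore] -/
theorem gpath_lev {g : W} {π : List X} {a b : X} (h : GPath H π a b) : GPath (F □ H) (lev g π) (g, a) (g, b) :=
  h.mapEmb (F.boxProdRight H g)

/-! ## §2 The leg lift: descend in the last-but-one column -/

/-- **THE LEG LIFT.**  A base self-avoiding leg `π : p ⇝ a` with at least two columns, a fibre level `x` and a target level `g`, `F` connected: there is a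
self-avoiding path of `F □ H` from `(x, p)` to `(g, a)` (the leg at level `x` up to its last-but-one column `n`, an `F`-path `x ⇝ g` over `n`, the last base step at
level `g`) whose columns lie on `π`, which visits the column `a` only at its end vertex `(g, a)`, and whose vertices over columns other than `n` and `a` have level
`x`; the last-but-one column `n` is on `π` and differs from `a`. [cite: DuminilCopinSidoraviciusTassion2016, §2.3 (proof of Fact 2: the paths γ_u, γ_v, γ_w)] -/
theorem exists_liftLeg (hF : F.Connected) {π : List X} {p a : X} (hπ : GPath H π p a) (h2 : 2 ≤ π.length) (x g : W) :
    ∃ (L : List (W × X)) (n : X), GPath (F □ H) L (x, p) (g, a) ∧ n ∈ π ∧ n ≠ a ∧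
      (∀ v ∈ L, v.2 ∈ π) ∧ (∀ v ∈ L, v.2 = a → v = (g, a)) ∧ (∀ v ∈ L, v.2 ≠ n → v.2 ≠ a → v.1 = x) := by
  -- split off the last column: `π = π₀ ++ [a]`, `π₀ : p ⇝ n` non-empty
  set π₀ : List X := π.dropLast with hπ₀
  have hsplit : π = π₀ ++ [a] := by
    rw [hπ₀]; conv_lhs => rw [← List.dropLast_append_getLast hπ.ne_nil, hπ.getLast_eq]
  have hπ₀ne : π₀ ≠ [] := by
    intro h0; rw [h0, List.nil_append] at hsplit; rw [hsplit] at h2; simp at h2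
  set n : X := π₀.getLast hπ₀ne with hn
  -- `π₀` is a base path from `p` to `n`, `n ∼ a`, `a ∉ π₀`
  have hch := hπ.chain
  rw [hsplit, List.isChain_append] at hch
  obtain ⟨hch₀, -, hna⟩ := hch
  have hna' : H.Adj n a := hna n (by rw [hn]; exact List.getLast?_eq_some_getLast hπ₀ne |>.symm ▸ rfl) a (by simp)
  have hnd := hπ.nodup
  rw [hsplit, List.nodup_append] at hnd
  obtain ⟨hnd₀, -, hdisj⟩ := hnd
  have haπ₀ : a ∉ π₀ := fun h => hdisj a h a (by simp) rfl
  have hnπ₀ : n ∈ π₀ := by rw [hn]; exact List.getLast_mem _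
  have hna_ne : n ≠ a := fun e => haπ₀ (e ▸ hnπ₀)
  have hP₀ : GPath H π₀ p n := by
    refine ⟨hπ₀ne, hch₀, hnd₀, ?_, by rw [hn]; exact List.getLast?_eq_some_getLast hπ₀ne⟩
    have := hπ.head
    rw [hsplit, List.head?_append] at this
    cases h0 : π₀.head? with
    | none => exact absurd (List.head?_eq_none_iff.1 h0) hπ₀ne
    | some b => rw [h0] at this; simpa using this
  -- the fibre path over `n`
  obtain ⟨P, hP⟩ := FinProdZ2.exists_gpath F hF x g
  -- assemble: level leg to `(x, n)`, column path to `(g, n)`, last step to `(g, a)`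
  have hA : GPath (F □ H) (lev x π₀) (x, p) (x, n) := gpath_lev F H hP₀
  have hB : GPath (F □ H) (col n P) (x, n) (g, n) := gpath_col F H hP
  have hAB : GPath (F □ H) (lev x π₀ ++ (col n P).tail) (x, p) (g, n) := by
    refine hA.trans hB fun v hvB hvA => ?_
    rw [mem_col] at hvB; rw [mem_lev] at hvA
    exact Prod.ext hvA.2 hvB.1
  have hstep : (F □ H).Adj (g, n) (g, a) := by
    rw [boxProd_adj]; exact Or.inr ⟨hna', rfl⟩
  have hC : GPath (F □ H) [(g, n), (g, a)] (g, n) (g, a) := GPath.pair hstep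
  have hmemAB : ∀ v ∈ lev x π₀ ++ (col n P).tail, v.2 ∈ π₀ := by
    intro v hv
    rcases List.mem_append.1 hv with hv | hv
    · exact (mem_lev.1 hv).1
    · have := mem_col.1 (List.tail_subset _ hv); rw [this.1]; exact hnπ₀
  have hL : GPath (F □ H) ((lev x π₀ ++ (col n P).tail) ++ [(g, n), (g, a)].tail) (x, p) (g, a) := by
    refine hAB.trans hC fun v hvC hvAB => ?_
    rcases List.mem_cons.1 hvC with rfl | hvC
    · rfl
    · rw [List.mem_singleton] at hvC; subst hvC
      exact absurd (hmemAB _ hvAB) haπ₀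
  refine ⟨(lev x π₀ ++ (col n P).tail) ++ [(g, n), (g, a)].tail, n, hL, by rw [hsplit]; exact List.mem_append_left _ hnπ₀, hna_ne, ?_, ?_, ?_⟩
  · intro v hv
    rcases List.mem_append.1 hv with hv | hv
    · rw [hsplit]; exact List.mem_append_left _ (hmemAB v hv)
    · simp only [List.tail_cons, List.mem_singleton] at hv; subst hv; exact hπ.last_mem
  · intro v hv hva
    rcases List.mem_append.1 hv with hv | hv
    · exact absurd (hva ▸ hmemAB v hv) haπ₀
    · simpa using hv
  · intro v hv hvn hva
    rcases List.mem_append.1 hv with hv | hv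
    · rcases List.mem_append.1 hv with hv | hv
      · exact (mem_lev.1 hv).2
      · exact absurd (mem_col.1 (List.tail_subset _ hv)).1 hvn
    · simp only [List.tail_cons, List.mem_singleton] at hv; subst hv; exact absurd rfl hva

end FinProd

end Summit.CriticalPhenomena.PercolationContinuityZ3.Theorems.Transplant

end
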